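import Literature.MathematicalPhysics.QuantumFieldTheory.OSPointLabelledVectors
import HarnessLib

/-!
# The Gram configuration of the two labelled halves is the translated full configuration

Topic `Literature/MathematicalPhysics/QuantumFieldTheory`; support file (all proved; no new
definitions; no named facts) for the discharge of (A1) `OS1975_exists_timeContinuation`: the
combinatorial content of Osterwalder–Schrader II (Comm. Math. Phys. 42 (1975)), Ch. V (5.2)/(5.4),
`(Ψ_p(x', ξ̃; c_p,…,c_0), Ψ_q(x, ξ'; c_{p+1},…,c_k)) = S(…)`: the Gram configuration
(`OSPointVectors.gramConfig`) of the labelled configurations (`OSPointLabelledVectors.labCfg`) of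
the reversed left part and of the right part of `(c, ρ)` at the split `p`, with first times `x'`, `x`,
`x' + x = ρ_p`, is the full labelled configuration `labCfg c 0 ρ` translated in time by
`−(x' + ρ₀ + ⋯ + ρ_{p-1})`:

* `partialSum_blockRevLeft`, `partialSum_blockRight` — partial sums of the two blocks of gaps;
* `gramConfig_labCfg` — the configuration identity.

## References

* K. Osterwalder, R. Schrader, *Axioms for Euclidean Green's functions II*, Comm. Math. Phys.
  42 (1975) 281–305, Ch. V (5.2), (5.4); Ch. V.2 (5.17). [OsterwalderSchraderCMP1975]
-/

noncomputable section

namespace Literature.MathematicalPhysics.QuantumFieldTheory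

variable {d : ℕ} [NeZero d]

open Literature.MathematicalPhysics.QuantumLattice (SchwingerFamily timeReflection timeReflection_apply)
open Literature.MathematicalPhysics.QuantumLattice.SchwingerFamily
open Literature.MathematicalPhysics.QuantumFieldTheory.OSEnvelope

/-! ### Partial sums of the blocks of gaps -/

section PartialSums

variable {M : Type*} [AddCommGroup M] {k : ℕ}

/-- Partial sums of the reversed left block: `∑_{i<m} ρ_{p-1-i} = P(p) − P(p − m)` where
`P(j) = ρ₀ + ⋯ + ρ_{j-1}`. [folklore] -/
theorem partialSum_blockRevLeft (ρ : Fin k → M) (p : Fin k) {m : ℕ} (hm : m ≤ p) :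
    Fin.partialSum (blockRevLeft ρ p) ⟨m, by omega⟩ =
      Fin.partialSum ρ ⟨p, by omega⟩ - Fin.partialSum ρ ⟨p - m, by omega⟩ := by
  induction m with
  | zero => simp
  | succ m ih =>
    have hm' : m ≤ p := by omega
    have h1 : (⟨m + 1, by omega⟩ : Fin (p + 1)) = (⟨m, by omega⟩ : Fin p).succ := Fin.ext rfl
    have h2 : (⟨m, by omega⟩ : Fin (p + 1)) = (⟨m, by omega⟩ : Fin p).castSucc := Fin.ext rfl
    rw [h1, Fin.partialSum_succ, ← h2, ih hm', blockRevLeft_apply]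
    -- `P(p − m) = P(p − m − 1) + ρ_{p-1-m}`
    have h3 : (⟨p - m, by omega⟩ : Fin (k + 1)) = (⟨p - 1 - m, by omega⟩ : Fin k).succ := Fin.ext (by simp; omega)
    have h4 : (⟨p - (m + 1), by omega⟩ : Fin (k + 1)) = (⟨p - 1 - m, by omega⟩ : Fin k).castSucc :=
      Fin.ext (by simp; omega)
    rw [h3, Fin.partialSum_succ, ← h4]
    abel

/-- Partial sums of the right block: `∑_{i<j} ρ_{p+1+i} = P(p+1+j) − P(p+1)`. [folklore] -/
theorem partialSum_blockRight (ρ : Fin k → M) (p : Fin k) {j : ℕ} (hj : j ≤ k - 1 - p) :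
    Fin.partialSum (blockRight ρ p) ⟨j, by omega⟩ =
      Fin.partialSum ρ ⟨p + 1 + j, by omega⟩ - Fin.partialSum ρ ⟨p + 1, by omega⟩ := by
  induction j with
  | zero => simp
  | succ j ih =>
    have hj' : j ≤ k - 1 - p := by omega
    have h1 : (⟨j + 1, by omega⟩ : Fin (k - 1 - p + 1)) = (⟨j, by omega⟩ : Fin (k - 1 - p)).succ := Fin.ext rfl
    have h2 : (⟨j, by omega⟩ : Fin (k - 1 - p + 1)) = (⟨j, by omega⟩ : Fin (k - 1 - p)).castSucc := Fin.ext rfl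
    rw [h1, Fin.partialSum_succ, ← h2, ih hj', blockRight_apply]
    have h3 : (⟨p + 1 + (j + 1), by omega⟩ : Fin (k + 1)) = (⟨p + 1 + j, by omega⟩ : Fin k).succ := Fin.ext (by simp; omega)
    have h4 : (⟨p + 1 + j, by omega⟩ : Fin (k + 1)) = (⟨p + 1 + j, by omega⟩ : Fin k).castSucc := Fin.ext rfl
    rw [h3, Fin.partialSum_succ, ← h4]
    abel

/-- `P(p + 1) = P(p) + ρ_p`. [folklore] -/
theorem partialSum_succ_mk (ρ : Fin k → M) (p : Fin k) :
    Fin.partialSum ρ ⟨p + 1, by omega⟩ = Fin.partialSum ρ ⟨p, by omega⟩ + ρ p := by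
  have h1 : (⟨p + 1, by omega⟩ : Fin (k + 1)) = p.succ := Fin.ext rfl
  have h2 : (⟨p, by omega⟩ : Fin (k + 1)) = p.castSucc := Fin.ext rfl
  rw [h1, Fin.partialSum_succ, h2]

end PartialSums

/-! ### The configuration identity -/

section Config

variable {k : ℕ}

/-- The index identity of the split. [folklore] -/
theorem labSplit_add_eq (p : Fin k) : (p : ℕ) + 1 + (k - 1 - p + 1) = k + 1 := by omega

/-- The reversed left labels, re-reversed. [folklore] -/
theorem posRevLeft_rev {E : Type*} (c : Fin (k + 1) → E) (p : Fin k) (J : Fin (p + 1)) :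
    posRevLeft c p (Fin.rev J) = c ⟨J, by omega⟩ := by
  have hv : (p : ℕ) - (Fin.rev J : ℕ) = J := by rw [Fin.val_rev]; omega
  rw [posRevLeft_apply]
  exact congrArg c (Fin.ext hv)

/-- **The Gram configuration of the two labelled halves** of `(c, ρ)` at the split `p`, with first
times `x'`, `x`, `x' + x = ρ_p`, is the full labelled configuration translated in time by
`−(x' + ρ₀ + ⋯ + ρ_{p-1})`. [cite: OsterwalderSchraderCMP1975, Ch. V (5.2), (5.4)] -/
theorem gramConfig_labCfg (c : Fin (k + 1) → EuclideanSpace ℝ (Fin d)) (p : Fin k) (ρ : Fin k → ℝ) {x' x : ℝ}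
    (hsum : x' + x = ρ p) (J : Fin (p + 1 + (k - 1 - p + 1))) :
    gramConfig (labCfg (posRevLeft c p) x' (blockRevLeft ρ p)) (labCfg (posRight c p) x (blockRight ρ p)) J =
      labCfg c 0 ρ (Fin.cast (labSplit_add_eq p) J) + timeVec (-(x' + Fin.partialSum ρ ⟨p, by omega⟩)) := by
  induction J using Fin.addCases with
  | left J =>
    rw [gramConfig, Fin.append_left]
    have hJ : (J : ℕ) ≤ p := by have := J.2; omega
    have hrev : ((Fin.rev J : Fin (p + 1)) : ℕ) = p - J := by simp [Fin.val_rev]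
    have hcast : (Fin.cast (labSplit_add_eq p) (Fin.castAdd (k - 1 - p + 1) J) : Fin (k + 1)) = ⟨J, by omega⟩ :=
      Fin.ext (by simp)
    rw [hcast]
    ext μ
    by_cases hμ : μ = 0
    · subst hμ
      rw [timeReflection_apply, if_pos rfl, labCfg_apply_zero, PiLp.add_apply, labCfg_apply_zero, timeVec_apply', if_pos rfl]
      have hps : Fin.partialSum (blockRevLeft ρ p) (Fin.rev J) =
          Fin.partialSum ρ ⟨p, by omega⟩ - Fin.partialSum ρ ⟨p - (p - J), by omega⟩ := by
        have h := partialSum_blockRevLeft ρ p (m := p - J) (by omega)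
        rwa [show (⟨p - J, by omega⟩ : Fin (p + 1)) = Fin.rev J from Fin.ext (by simp [Fin.val_rev])] at h
      have hidx : (⟨p - (p - J), by omega⟩ : Fin (k + 1)) = ⟨J, by omega⟩ := Fin.ext (by simp; omega)
      rw [hps, hidx]
      ring
    · rw [timeReflection_apply, if_neg hμ, labCfg_apply_of_ne_zero _ _ _ _ hμ, PiLp.add_apply,
        labCfg_apply_of_ne_zero _ _ _ _ hμ, timeVec_apply', if_neg hμ, add_zero, posRevLeft_rev]
  | right j =>
    rw [gramConfig, Fin.append_right]
    have hj : (j : ℕ) ≤ k - 1 - p := by have := j.2; omega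
    have hcast : (Fin.cast (labSplit_add_eq p) (Fin.natAdd (p + 1) j) : Fin (k + 1)) = ⟨p + 1 + j, by omega⟩ :=
      Fin.ext (by simp)
    rw [hcast]
    ext μ
    by_cases hμ : μ = 0
    · subst hμ
      rw [labCfg_apply_zero, PiLp.add_apply, labCfg_apply_zero, timeVec_apply', if_pos rfl]
      have hps : Fin.partialSum (blockRight ρ p) j =
          Fin.partialSum ρ ⟨p + 1 + j, by omega⟩ - Fin.partialSum ρ ⟨p + 1, by omega⟩ := by
        have h := partialSum_blockRight ρ p (j := j) hj
        rwa [show (⟨j, by omega⟩ : Fin (k - 1 - p + 1)) = j from Fin.ext rfl] at h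
      rw [hps, partialSum_succ_mk]
      linarith
    · rw [labCfg_apply_of_ne_zero _ _ _ _ hμ, PiLp.add_apply, labCfg_apply_of_ne_zero _ _ _ _ hμ, timeVec_apply',
        if_neg hμ, add_zero, posRight_apply]

end Config

end Literature.MathematicalPhysics.QuantumFieldTheory
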